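import Summits.CriticalPhenomena.PercolationContinuityZ3.Theorems.PercNearOneGluingNoHeavyConstsHardCoreReductionSplit
import HarnessLib

/-!
# Hard-core reduction of `Consts.HardCoreBHK`, III: the reduction theorem `HardCoreBHK ↔ hard-core Harris`

builds on p205010 (kernel theorem, internal audit signed; external expert review pending).  Support file (`--supports
stmt-CriticalPhenomena-4575`), lead seat `prim-nh-lead-4575` (gen 105); memo `run/shared/lean/prim/prim-nh-lead-4575/LEAD-GEN105.md` §1(1).
Theorems only; no sorries; standard axioms; default heartbeats.

* `count_le_count_of_empty` — the recursion of part II closes: if the normal-form inequality `K_{Φ₁} ≤ K_{Φ₂}` holds at `T = ∅` for all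
  hard-core sets and fibres, it holds for every repelled set `T` (strong induction on the number of live pairs `|M ∪ u|`; each step
  rewrites both sides as the same ℕ-combination of instances with fewer live pairs, or passes to `T = ∅` when `T` is isolated).
* `hardCoreBHK_iff_hardCoreHarris` — **`Consts.HardCoreBHK` is equivalent to its `T = ∅` slice** ("hard-core Harris", (HC)):
  for two copies `a`, `a ∆ M` of a folding fibre and a hard-core set `N` met by at most one of the two union clusters,
  `#{P(C_S a), Q(C_S (a ∆ M))} ≤ #{P(C_S a), Q(C_S a)}` for increasing `P`, `Q`.  So the repelled set of the
  van den Berg–Häggström–Kahn theorems costs nothing fibrewise; what remains open is the hard-core Harris inequality itself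
  (`N = ∅` is Harris' inequality on the fibre; exact census of the lead: 0 violations in 1.03 · 10⁸ instances, memo §1(3)).
* `fibrewiseBHK_of_hardCoreHarris` — hence (HC) implies `Consts.FibrewiseBHK` (PA-BERN).
[cite: VandenbergHaggstromKahn2005, Thm. 1.1 proof (pp. 3–5); Thm. 1.3 (p. 6)]
-/

namespace Summit.CriticalPhenomena.PercolationContinuityZ3.Theorems

open Set Literature.Probability.Percolation
open scoped Classical symmDiff

namespace Consts.HardCoreReduction

/-! ### The reduction theorem: hard-core Harris (`T = ∅`) implies `Consts.HardCoreBHK` -/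

section Reduction

variable {V : Type*} [Fintype V]

/-- **The recursion closes**: if the normal-form inequality `K_L ≤ K_R` holds for `T = ∅` (all `N, M, u`), it holds for all `T` —
strong induction on the number of live coordinates `|M ∪ u|`, using `count_split`, `count_forced`, `count_inside_M/u`,
`count_isolated` and `count_eq_zero_of_not_disjoint`. [folklore] -/
theorem count_le_count_of_empty (S : Set V) (Φ₁ Φ₂ : BondConfig V → BondConfig V → Prop)
    (hΦL : ∀ a a' b b' : BondConfig V,
      (⋃ s ∈ S, openEdgeCluster (a) s) = (⋃ s ∈ S, openEdgeCluster (a') s) →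
      (⋃ s ∈ S, openEdgeCluster (b) s) = (⋃ s ∈ S, openEdgeCluster (b') s) → (Φ₁ a b ↔ Φ₁ a' b'))
    (hΦR : ∀ a a' b b' : BondConfig V,
      (⋃ s ∈ S, openEdgeCluster (a) s) = (⋃ s ∈ S, openEdgeCluster (a') s) →
      (⋃ s ∈ S, openEdgeCluster (b) s) = (⋃ s ∈ S, openEdgeCluster (b') s) → (Φ₂ a b ↔ Φ₂ a' b'))
    (h0 : ∀ (N : Set V) (M u : Set (Sym2 V)), Disjoint u M →
      (Finset.univ.filter fun a : BondConfig V => a \ (M) = u ∧ ((∀ w ∈ N, ¬ ((∃ s ∈ S, (openGraph (a)).Reachable s w) ∧ (∃ s ∈ S, (openGraph (a ∆ (M))).Reachable s w))) ∧ (∀ s ∈ S, ∀ t ∈ (∅ : Set V), ¬ (openGraph (a)).Reachable s t) ∧ (∀ s ∈ S, ∀ t ∈ (∅ : Set V), ¬ (openGraph (a ∆ (M))).Reachable s t) ∧ Φ₁ (a) (a ∆ (M)))).card ≤ (Finset.univ.filter fun a : BondConfig V => a \ (M) = u ∧ ((∀ w ∈ N, ¬ ((∃ s ∈ S, (openGraph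 (a)).Reachable s w) ∧ (∃ s ∈ S, (openGraph (a ∆ (M))).Reachable s w))) ∧ (∀ s ∈ S, ∀ t ∈ (∅ : Set V), ¬ (openGraph (a)).Reachable s t) ∧ (∀ s ∈ S, ∀ t ∈ (∅ : Set V), ¬ (openGraph (a ∆ (M))).Reachable s t) ∧ Φ₂ (a) (a ∆ (M)))).card) :
    ∀ (k : ℕ) (T N : Set V) (M u : Set (Sym2 V)), Disjoint u M → (M ∪ u).ncard = k →
      (Finset.univ.filter fun a : BondConfig V => a \ (M) = u ∧ ((∀ w ∈ N, ¬ ((∃ s ∈ S, (openGraph (a)).Reachable s w) ∧ (∃ s ∈ S, (openGraph (a ∆ (M))).Reachable s w))) ∧ (∀ s ∈ S, ∀ t ∈ T, ¬ (openGraph (a)).Reachable s t) ∧ (∀ s ∈ S, ∀ t ∈ T, ¬ (openGraph (a ∆ (M))).Reachable s t) ∧ Φ₁ (a) (a ∆ (M)))).card ≤ (Finset.univ.filter fun a : BondConfig V => a \ (M) = u ∧ ((∀ w ∈ N, ¬ ((∃ s ∈ S, (openGraph (a)).Reachable s w) ∧ (∃ s ∈ S, (openGraph (a ∆ (M))).Reachable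 s w))) ∧ (∀ s ∈ S, ∀ t ∈ T, ¬ (openGraph (a)).Reachable s t) ∧ (∀ s ∈ S, ∀ t ∈ T, ¬ (openGraph (a ∆ (M))).Reachable s t) ∧ Φ₂ (a) (a ∆ (M)))).card := by
  classical
  intro k
  induction k using Nat.strong_induction_on with
  | _ k ih =>
  intro T N M u huM hk
  -- measure bookkeeping: removing a nonempty block of live coordinates decreases `|M ∪ u|`
  have hlt : ∀ F : Set (Sym2 V), F ⊆ M ∪ u → F.Nonempty → ((M ∪ u) \ F).ncard < k := by
    intro F hF hFne
    rw [← hk]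
    refine Set.ncard_lt_ncard ?_ (Set.toFinite _)
    refine Set.ssubset_iff_subset_ne.2 ⟨Set.sdiff_subset, fun heq => ?_⟩
    obtain ⟨e, he⟩ := hFne
    have : e ∈ (M ∪ u) \ F := by rw [heq]; exact hF he
    exact this.2 he
  by_cases hST : Disjoint S T
  swap
  · rw [count_eq_zero_of_not_disjoint S T N Φ₁ M u hST]
    exact Nat.zero_le _
  by_cases hlive : ∃ e ∈ M ∪ u, ∃ t ∈ T, t ∈ e
  · obtain ⟨e, heMu, t, ht, hte⟩ := hlive
    -- the other endpoint
    set x := Sym2.Mem.other hte with hx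
    have hex : e = s(t, x) := (Sym2.other_spec hte).symm
    by_cases hxT : x ∈ T
    · -- a pair inside `T`
      have hex' : e = s(x, t) := by rw [hex, Sym2.eq_swap]
      rcases heMu with heM | heu
      · rw [hex'] at heM
        have e1 := count_inside_M S T N Φ₁ hΦL M u huM ht hxT heM
        have e2 := count_inside_M S T N Φ₂ hΦR M u huM ht hxT heM
        rw [e1, e2]
        refine Nat.mul_le_mul_left _ (ih ((M \ {s(x, t)} ∪ u).ncard) ?_ T N (M \ {s(x, t)}) u (huM.mono_right Set.sdiff_subset) rfl)
        have hsub : ({s(x, t)} : Set (Sym2 V)) ⊆ M ∪ u := Set.singleton_subset_iff.2 (Or.inl heM)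
        have heu : s(x, t) ∉ u := fun h' => Set.disjoint_left.1 huM h' heM
        have : M \ {s(x, t)} ∪ u = (M ∪ u) \ {s(x, t)} := by
          ext f; simp only [Set.mem_union, Set.mem_sdiff, Set.mem_singleton_iff]
          constructor
          · rintro (⟨hfM, hne⟩ | hfu)
            · exact ⟨Or.inl hfM, hne⟩
            · exact ⟨Or.inr hfu, fun hfe => heu (hfe ▸ hfu)⟩
          · rintro ⟨hf | hf, hne⟩
            · exact Or.inl ⟨hf, hne⟩
            · exact Or.inr hf
        rw [this]
        exact hlt _ hsub (Set.singleton_nonempty _)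
      · rw [hex'] at heu
        have e1 := count_inside_u S T N Φ₁ hΦL M u huM ht hxT heu
        have e2 := count_inside_u S T N Φ₂ hΦR M u huM ht hxT heu
        rw [e1, e2]
        refine ih ((M ∪ u \ {s(x, t)}).ncard) ?_ T N M (u \ {s(x, t)}) (huM.mono_left Set.sdiff_subset) rfl
        have hsub : ({s(x, t)} : Set (Sym2 V)) ⊆ M ∪ u := Set.singleton_subset_iff.2 (Or.inr heu)
        have heM : s(x, t) ∉ M := fun h' => Set.disjoint_left.1 huM heu h'
        have : M ∪ u \ {s(x, t)} = (M ∪ u) \ {s(x, t)} := by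
          ext f; simp only [Set.mem_union, Set.mem_sdiff, Set.mem_singleton_iff]
          constructor
          · rintro (hfM | ⟨hfu, hne⟩)
            · exact ⟨Or.inl hfM, fun hfe => heM (hfe ▸ hfM)⟩
            · exact ⟨Or.inr hfu, hne⟩
          · rintro ⟨hf | hf, hne⟩
            · exact Or.inl hf
            · exact Or.inr ⟨hf, hne⟩
        rw [this]
        exact hlt _ hsub (Set.singleton_nonempty _)
    · -- a pair from `v := x ∉ T` to `T`: split at the star of `v`
      have hstar_sub : {f : Sym2 V | ∃ t' ∈ T, f = s(x, t')} ⊆ {f | ∃ t' ∈ T, t' ∈ f} := by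
        rintro f ⟨t', ht', rfl⟩; exact ⟨t', ht', Sym2.mem_mk_right x t'⟩
      have hestar : e ∈ {f : Sym2 V | ∃ t' ∈ T, f = s(x, t')} := ⟨t, ht, by rw [hex, Sym2.eq_swap]⟩
      by_cases hu : (u ∩ {f : Sym2 V | ∃ t' ∈ T, f = s(x, t')}).Nonempty
      · -- FORCED: some pair of the star is open in both copies
        have hFu : u ∩ {f : Sym2 V | ∃ t' ∈ T, f = s(x, t')} ⊆ u := Set.inter_subset_left
        have hF : ∀ f ∈ u ∩ {f : Sym2 V | ∃ t' ∈ T, f = s(x, t')}, ∃ t' ∈ T, f = s(x, t') := fun f hf => hf.2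
        have e1 := count_forced S T N Φ₁ hΦL M u _ huM hFu x hF hu
        have e2 := count_forced S T N Φ₂ hΦR M u _ huM hFu x hF hu
        have hFM : Disjoint (u ∩ {f : Sym2 V | ∃ t' ∈ T, f = s(x, t')}) M := huM.mono_left hFu
        have hdisj : Disjoint (u \ (u ∩ {f : Sym2 V | ∃ t' ∈ T, f = s(x, t')})) M := huM.mono_left Set.sdiff_subset
        have hmeas : (M ∪ (u \ (u ∩ {f : Sym2 V | ∃ t' ∈ T, f = s(x, t')}))).ncard < k := by
          have : M ∪ (u \ (u ∩ {f : Sym2 V | ∃ t' ∈ T, f = s(x, t')})) =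
              (M ∪ u) \ (u ∩ {f : Sym2 V | ∃ t' ∈ T, f = s(x, t')}) := by
            rw [Set.union_sdiff_distrib, sdiff_eq_left.2 hFM.symm]
          rw [this]
          exact hlt _ (hFu.trans Set.subset_union_right) hu
        have ih1 := ih _ hmeas (insert x T) N M (u \ (u ∩ {f : Sym2 V | ∃ t' ∈ T, f = s(x, t')})) hdisj rfl
        rw [e1, e2]
        -- `convert`, not `exact`: the `Decidable` instances behind `Finset.filter` differ after substituting `insert x T`
        convert ih1 using 3
      · -- SPLIT at the `M`-pairs of the star
        rw [Set.not_nonempty_iff_eq_empty] at hu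
        have heM : e ∈ M := by
          rcases heMu with heM | heu
          · exact heM
          · have : e ∈ u ∩ {f : Sym2 V | ∃ t' ∈ T, f = s(x, t')} := ⟨heu, hestar⟩
            rw [hu] at this; exact this.elim
        have hFM : M ∩ {f : Sym2 V | ∃ t' ∈ T, f = s(x, t')} ⊆ M := Set.inter_subset_left
        have hF : ∀ f ∈ M ∩ {f : Sym2 V | ∃ t' ∈ T, f = s(x, t')}, ∃ t' ∈ T, f = s(x, t') := fun f hf => hf.2
        have hFne : (M ∩ {f : Sym2 V | ∃ t' ∈ T, f = s(x, t')}).Nonempty := ⟨e, heM, hestar⟩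
        have e1 := count_split S T N Φ₁ hΦL M u _ huM hFM x hF hFne
        have e2 := count_split S T N Φ₂ hΦR M u _ huM hFM x hF hFne
        rw [e1, e2]
        have hdisj : Disjoint u (M \ (M ∩ {f : Sym2 V | ∃ t' ∈ T, f = s(x, t')})) :=
          huM.mono_right Set.sdiff_subset
        have hmeas : (M \ (M ∩ {f : Sym2 V | ∃ t' ∈ T, f = s(x, t')}) ∪ u).ncard < k := by
          have hFu' : Disjoint (M ∩ {f : Sym2 V | ∃ t' ∈ T, f = s(x, t')}) u := by
            refine Set.disjoint_left.2 fun f hf hfu => ?_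
            have : f ∈ u ∩ {f : Sym2 V | ∃ t' ∈ T, f = s(x, t')} := ⟨hfu, hf.2⟩
            rw [hu] at this; exact this
          have : M \ (M ∩ {f : Sym2 V | ∃ t' ∈ T, f = s(x, t')}) ∪ u =
              (M ∪ u) \ (M ∩ {f : Sym2 V | ∃ t' ∈ T, f = s(x, t')}) := by
            rw [Set.union_sdiff_distrib, sdiff_eq_left.2 hFu'.symm]
          rw [this]
          exact hlt _ (hFM.trans Set.subset_union_left) hFne
        have ih1 := ih _ hmeas (insert x T) N (M \ (M ∩ {f : Sym2 V | ∃ t' ∈ T, f = s(x, t')})) u hdisj rfl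
        have ih2 := ih _ hmeas T (insert x N) (M \ (M ∩ {f : Sym2 V | ∃ t' ∈ T, f = s(x, t')})) u hdisj rfl
        refine Nat.add_le_add (Nat.mul_le_mul_left _ ?_) ?_
        · convert ih1 using 3
        · convert ih2 using 3
  · -- ISOLATED `T`: the `T`-conditions are automatic; use the hypothesis at `T = ∅`
    have hiso : ∀ e ∈ M ∪ u, ¬ ∃ t ∈ T, t ∈ e := fun e he hex => hlive ⟨e, he, hex⟩
    rw [count_isolated S T N Φ₁ M u hiso hST, count_isolated S T N Φ₂ M u hiso hST]
    exact h0 N M u huM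

/-- **REDUCTION THEOREM (lead gen 105): the `T = ∅` slice of `Consts.HardCoreBHK` ("hard-core Harris", (HC)) implies the whole of
`Consts.HardCoreBHK`, hence (with `Consts.fibrewiseBHK_of_hardCoreBHK`) the fibrewise van den Berg–Häggström–Kahn conjecture
`Consts.FibrewiseBHK` (PA-BERN).**  Proof: the per-vertex recursion `count_split` / `count_forced` / `count_inside_M` /
`count_inside_u` writes both sides of the inequality for `(T, N, M, u)` as the same ℕ-combination of the sides of instances with
fewer live coordinates, until `T` is isolated (`count_isolated`), where the statement is the hypothesis.  BHK's block step made
fibrewise: the residue of the repelled set is a hard-core interaction between the two copies.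
[cite: VandenbergHaggstromKahn2005, Thm. 1.1 proof (pp. 3–5): induction on the number of vertices, conditioning at `Z = X ∩ Y` (identity (6))] -/
theorem hardCoreBHK_of_hardCoreHarris
    (h : ∀ (n : ℕ) (S N : Set (Fin n)) (P Q : Set (Sym2 (Fin n)) → Prop),
      (∀ ⦃C C' : Set (Sym2 (Fin n))⦄, C ⊆ C' → P C → P C') →
      (∀ ⦃C C' : Set (Sym2 (Fin n))⦄, C ⊆ C' → Q C → Q C') →
      ∀ M u : Set (Sym2 (Fin n)), Disjoint u M →
        (Finset.univ.filter fun a : BondConfig (Fin n) =>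
          a \ M = u ∧
            (∀ v ∈ N, ¬ ((∃ s ∈ S, (openGraph a).Reachable s v) ∧ (∃ s ∈ S, (openGraph (a ∆ M)).Reachable s v))) ∧
            a ∈ ({ω : BondConfig (Fin n) | ∀ s ∈ S, ∀ t ∈ (∅ : Set (Fin n)), ¬ (openGraph ω).Reachable s t} ∩
                  {ω | P (⋃ s ∈ S, openEdgeCluster ω s)}) ∧
            a ∆ M ∈ ({ω : BondConfig (Fin n) | ∀ s ∈ S, ∀ t ∈ (∅ : Set (Fin n)), ¬ (openGraph ω).Reachable s t} ∩
                  {ω | Q (⋃ s ∈ S, openEdgeCluster ω s)})).card ≤ (Finset.univ.filter fun a : BondConfig (Fin n) =>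
          a \ M = u ∧
            (∀ v ∈ N, ¬ ((∃ s ∈ S, (openGraph a).Reachable s v) ∧ (∃ s ∈ S, (openGraph (a ∆ M)).Reachable s v))) ∧
            a ∈ ({ω : BondConfig (Fin n) | ∀ s ∈ S, ∀ t ∈ (∅ : Set (Fin n)), ¬ (openGraph ω).Reachable s t} ∩
                  {ω | P (⋃ s ∈ S, openEdgeCluster ω s)} ∩ {ω | Q (⋃ s ∈ S, openEdgeCluster ω s)}) ∧
            a ∆ M ∈ {ω : BondConfig (Fin n) | ∀ s ∈ S, ∀ t ∈ (∅ : Set (Fin n)), ¬ (openGraph ω).Reachable s t}).card) :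
    HardCoreBHK := by
  classical
  intro n S T N P Q hP hQ M u hu
  have hΦL : ∀ a a' b b' : BondConfig (Fin n),
      (⋃ s ∈ S, openEdgeCluster (a) s) = (⋃ s ∈ S, openEdgeCluster (a') s) →
      (⋃ s ∈ S, openEdgeCluster (b) s) = (⋃ s ∈ S, openEdgeCluster (b') s) →
      ((fun a b : BondConfig (Fin n) => P (⋃ s ∈ S, openEdgeCluster (a) s) ∧ Q (⋃ s ∈ S, openEdgeCluster (b) s)) a b ↔ (fun a b : BondConfig (Fin n) => P (⋃ s ∈ S, openEdgeCluster (a) s) ∧ Q (⋃ s ∈ S, openEdgeCluster (b) s)) a' b') := by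
    intro a a' b b' h1 h2
    simp only [h1, h2]
  have hΦR : ∀ a a' b b' : BondConfig (Fin n),
      (⋃ s ∈ S, openEdgeCluster (a) s) = (⋃ s ∈ S, openEdgeCluster (a') s) →
      (⋃ s ∈ S, openEdgeCluster (b) s) = (⋃ s ∈ S, openEdgeCluster (b') s) →
      ((fun a _b : BondConfig (Fin n) => P (⋃ s ∈ S, openEdgeCluster (a) s) ∧ Q (⋃ s ∈ S, openEdgeCluster (a) s)) a b ↔ (fun a _b : BondConfig (Fin n) => P (⋃ s ∈ S, openEdgeCluster (a) s) ∧ Q (⋃ s ∈ S, openEdgeCluster (a) s)) a' b') := by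
    intro a a' b b' h1 _
    simp only [h1]
  have key := count_le_count_of_empty (V := Fin n) S (fun a b : BondConfig (Fin n) => P (⋃ s ∈ S, openEdgeCluster (a) s) ∧ Q (⋃ s ∈ S, openEdgeCluster (b) s)) (fun a _b : BondConfig (Fin n) => P (⋃ s ∈ S, openEdgeCluster (a) s) ∧ Q (⋃ s ∈ S, openEdgeCluster (a) s)) hΦL hΦR (by
      intro N' M' u' hu'
      have h' := h n S N' P Q hP hQ M' u' hu'
      convert h' using 2 <;>
      · ext a
        simp only [Finset.mem_filter, Finset.mem_univ, true_and, Set.mem_inter_iff, Set.mem_setOf_eq]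
        tauto) _ T N M u hu rfl
  convert key using 2 <;>
  · ext a
    simp only [Finset.mem_filter, Finset.mem_univ, true_and, Set.mem_inter_iff, Set.mem_setOf_eq]
    tauto

/-- **EQUIVALENCE: `Consts.HardCoreBHK` (all repelled sets `T`) is equivalent to its `T = ∅` slice ("hard-core Harris").**
The repelled set of the van den Berg–Häggström–Kahn theorems carries no extra difficulty fibrewise: what is left after the
per-vertex recursion is exactly the hard-core interaction between the two copies.
[cite: VandenbergHaggstromKahn2005, Thm. 1.1 proof (pp. 3–5)] -/
theorem hardCoreBHK_iff_hardCoreHarris :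
    HardCoreBHK ↔
      ∀ (n : ℕ) (S N : Set (Fin n)) (P Q : Set (Sym2 (Fin n)) → Prop),
        (∀ ⦃C C' : Set (Sym2 (Fin n))⦄, C ⊆ C' → P C → P C') →
        (∀ ⦃C C' : Set (Sym2 (Fin n))⦄, C ⊆ C' → Q C → Q C') →
        ∀ M u : Set (Sym2 (Fin n)), Disjoint u M →
          (Finset.univ.filter fun a : BondConfig (Fin n) =>
          a \ M = u ∧
            (∀ v ∈ N, ¬ ((∃ s ∈ S, (openGraph a).Reachable s v) ∧ (∃ s ∈ S, (openGraph (a ∆ M)).Reachable s v))) ∧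
            a ∈ ({ω : BondConfig (Fin n) | ∀ s ∈ S, ∀ t ∈ (∅ : Set (Fin n)), ¬ (openGraph ω).Reachable s t} ∩
                  {ω | P (⋃ s ∈ S, openEdgeCluster ω s)}) ∧
            a ∆ M ∈ ({ω : BondConfig (Fin n) | ∀ s ∈ S, ∀ t ∈ (∅ : Set (Fin n)), ¬ (openGraph ω).Reachable s t} ∩
                  {ω | Q (⋃ s ∈ S, openEdgeCluster ω s)})).card ≤ (Finset.univ.filter fun a : BondConfig (Fin n) =>
          a \ M = u ∧
            (∀ v ∈ N, ¬ ((∃ s ∈ S, (openGraph a).Reachable s v) ∧ (∃ s ∈ S, (openGraph (a ∆ M)).Reachable s v))) ∧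
            a ∈ ({ω : BondConfig (Fin n) | ∀ s ∈ S, ∀ t ∈ (∅ : Set (Fin n)), ¬ (openGraph ω).Reachable s t} ∩
                  {ω | P (⋃ s ∈ S, openEdgeCluster ω s)} ∩ {ω | Q (⋃ s ∈ S, openEdgeCluster ω s)}) ∧
            a ∆ M ∈ {ω : BondConfig (Fin n) | ∀ s ∈ S, ∀ t ∈ (∅ : Set (Fin n)), ¬ (openGraph ω).Reachable s t}).card := by
  refine ⟨fun h n S N P Q hP hQ M u hu => ?_, hardCoreBHK_of_hardCoreHarris⟩
  -- `convert`: the `Decidable` instances behind `Finset.filter` differ after substituting `T := ∅`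
  convert h n S ∅ N P Q hP hQ M u hu using 3

/-- **Corollary: hard-core Harris implies the fibrewise van den Berg–Häggström–Kahn conjecture (PA-BERN).**
[cite: VandenbergHaggstromKahn2005, Thm. 1.3 (p. 6)] -/
theorem fibrewiseBHK_of_hardCoreHarris
    (h : ∀ (n : ℕ) (S N : Set (Fin n)) (P Q : Set (Sym2 (Fin n)) → Prop),
      (∀ ⦃C C' : Set (Sym2 (Fin n))⦄, C ⊆ C' → P C → P C') →
      (∀ ⦃C C' : Set (Sym2 (Fin n))⦄, C ⊆ C' → Q C → Q C') →
      ∀ M u : Set (Sym2 (Fin n)), Disjoint u M →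
        (Finset.univ.filter fun a : BondConfig (Fin n) =>
          a \ M = u ∧
            (∀ v ∈ N, ¬ ((∃ s ∈ S, (openGraph a).Reachable s v) ∧ (∃ s ∈ S, (openGraph (a ∆ M)).Reachable s v))) ∧
            a ∈ ({ω : BondConfig (Fin n) | ∀ s ∈ S, ∀ t ∈ (∅ : Set (Fin n)), ¬ (openGraph ω).Reachable s t} ∩
                  {ω | P (⋃ s ∈ S, openEdgeCluster ω s)}) ∧
            a ∆ M ∈ ({ω : BondConfig (Fin n) | ∀ s ∈ S, ∀ t ∈ (∅ : Set (Fin n)), ¬ (openGraph ω).Reachable s t} ∩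
                  {ω | Q (⋃ s ∈ S, openEdgeCluster ω s)})).card ≤ (Finset.univ.filter fun a : BondConfig (Fin n) =>
          a \ M = u ∧
            (∀ v ∈ N, ¬ ((∃ s ∈ S, (openGraph a).Reachable s v) ∧ (∃ s ∈ S, (openGraph (a ∆ M)).Reachable s v))) ∧
            a ∈ ({ω : BondConfig (Fin n) | ∀ s ∈ S, ∀ t ∈ (∅ : Set (Fin n)), ¬ (openGraph ω).Reachable s t} ∩
                  {ω | P (⋃ s ∈ S, openEdgeCluster ω s)} ∩ {ω | Q (⋃ s ∈ S, openEdgeCluster ω s)}) ∧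
            a ∆ M ∈ {ω : BondConfig (Fin n) | ∀ s ∈ S, ∀ t ∈ (∅ : Set (Fin n)), ¬ (openGraph ω).Reachable s t}).card) :
    FibrewiseBHK :=
  fibrewiseBHK_of_hardCoreBHK (hardCoreBHK_of_hardCoreHarris h)

end Reduction

end Consts.HardCoreReduction

end Summit.CriticalPhenomena.PercolationContinuityZ3.Theorems
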